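import Summits.QuantumFields.BalabanUV.Beta.FP.CoarseCovarianceElliptic
import Summits.QuantumFields.BalabanUV.Beta.FP.CoarseCovarianceAliasBF
import Summits.QuantumFields.BalabanUV.Beta.GAN24.AliasWeightsClosedForm

/-!
# `BalabanUV.Beta.FP.CoarseCovarianceEllipticBound` — road «FP» (binder row D1), row H′2-IR ∕ IR-2 leaf (iii) «n-UNIFORM REAL-ZONE ELLIPTICITY», file 2∕2:
# **`Re v†Ĉ_n^{BF,mean}(k)v ≥ cEll(d)·n²∕n^{d+1}·‖k‖∞⁻²·Σ‖v‖²`** on the punctured real zone for EVERY `d` and `n ≥ 1` (so `≥ c·n⁻²·min(1,|k|⁻²)‖v‖²` at `d+1 = 4`),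
# with the NAMED single-alias-term extraction `re_quad_covSym(Mean)_PbfSym_ge_alias` (any `l`; the owner asked for it by name — IR-3-ELL's alias bound reuses it)

NOT IN PRINT; OUR BOOKKEEPING, for the road-FP OWNER's ROW REFINEMENT «IR-2 (i)–(iii)» (journal l.21049; (iii) booked to this seat l.≈21670; `H2IR-DESIGN.md` §IR-2 (iii)).
ROUTE: by file 3∕3 of (i) (`CoarseCovarianceAliasBF.covSym_PbfSym_ofRealVec`) the form of `Ĉ_n^{BF}(k)` is the alias average of the propagator forms
`quad (P̂(k_l)) (u_l)` at the weighted vectors `u_l := conj (cweight n · (k_l)) · v` (`re_quad_covSym_PbfSym_eq`); EVERY term is `≥ 0`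
(`CoarseCovarianceElliptic.re_quad_PinfSym_nonneg`), so the form dominates ANY single term (`re_quad_covSym_PbfSym_ge_alias`); at `l = 0`, `k_0 = k∕n ∈ [−π∕n,π∕n]^{d+1}`,
the contour weight is large — `‖cweight n κ (k∕n)‖ ≥ (2n∕π)^{d+2}` (road P1 ∕ leaf-17's Jordan bound `AliasWeightsClosedForm.two_div_pi_mul_le_norm_geomExp`, `d+2` times) —
and the propagator form is `≥ Σ‖u‖²∕((π²∕4)^{2d+6}·Σ_a‖e^{i s_a}−1‖²) ≥ n²·Σ‖u‖²∕((π²∕4)^{2d+6}(d+1)‖k‖∞²)` (`re_quad_PinfSym_ge`, `2 − 2cos x ≤ x²`).  No strip, no holomorphy.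

## What is proved (`0 sorry`, every `d`, `n ≥ 1`)
* §1 [folklore] `abs_wrapPt_of_mem`, `norm_wrapPt_of_mem`, `wrapPt_ne_zero_of_mem` (the `toIocMod` wrap preserves `|·|` on the closed zone), `apt_zero_mem_BZ`, `apt_zero_apply`,
  **`norm_cweight_apt_zero_ge`** (`(2n∕π)^{d+2} ≤ ‖cweight n κ (ofRealVec (k∕n))‖`, `k ∈ BZ`).
* §2 [our object] `quad_diag_weight`, **`quad_covSym_PbfSym_eq`** (`Σ_κλ conj(v κ)·Ĉ_n^{BF}(k)_κλ·v λ = (n^{d+1})⁻¹ Σ_l quad (P̂(k_l)) (u_l)`),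
  **`re_quad_covSym_PbfSym_ge_alias`** ∕ **`re_quad_covSymMean_PbfSym_ge_alias`** — THE NAMED EXTRACTION: for ANY alias index `a`,
  `(n^{d+1})⁻¹·Re quad (P̂(k_a)) (u_a) ≤ Re v†Ĉ_n^{BF}(k)v` (resp. `× (n^{d+2})⁻²` for `Ĉ_n^{BF,mean}`), ANY real `k` (no zone hypothesis).
* §3 [our object] **`re_quad_covSymMean_PbfSym_ge`** — THE (iii) BOUND: for `k ∈ BZ`, `k ≠ 0`, `v : ℂ^{d+1}`,
  `(2∕π)^{2d+4}∕((π²∕4)^{2(d+1)+4}(d+1)) · (n²∕n^{d+1}) · ‖k‖⁻² · Σ‖v‖² ≤ Re Σ_κλ conj(v κ)·covSymMean n κ λ (PbfSym κ λ) (ofRealVec k)·v λ` (sup norm);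
  `re_quad_covSymMean_PbfSym_ge_four` (`d+1 = 4`: `… · (n²)⁻¹ · ‖k‖⁻² · Σ‖v‖²`), `re_quad_covSymMean_PbfSym_ge_min` (the design memo's `min(1,‖k‖⁻²)` form), `cEll_pos`.
HONEST FRAMING: a lower bound on the cell's own U = 1 symbol; 0 estimates of Bałaban's objects; 0∕4 row-D1 binders; NOT D1, NOT BetaPertH, NOT the continuum limit, NOT Clay.
HONEST DEPENDENCY (verbatim): «continuum YM on T⁴ ⇐ BetaPertH ∧ nine spine estimates (0/9 proved); BetaPertH ⇐ (D1) ∧ (D4) ∧ CAP+tail; G-an2-4 gates asym, D1 and NE2/3/4.»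
ABSOLUTE RULE respected: no cited fact, no `def … : Prop`, nothing of the manuscripts asserted.
Provenance: D1 formalisation swarm leaf prover 02, gen 7 (prover-b2b-balaban-beta-d1-formalise-leaf-02-g7-0), road-FP row IR-2 (iii) (OFFER l.21538, owner booking l.≈21670), 2026-08-20.
-/

noncomputable section

open Complex Set MeasureTheory Finset Matrix
open scoped Real BigOperators ComplexConjugate
open Literature.MathematicalPhysics.QuantumFieldTheory.Balaban1983to89
open Literature.MathematicalPhysics.QuantumFieldTheory.Balaban1983to89.Beta
open B4Strip (ofRealVec)
open B4ContourShift (BZ)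
open B5Prop11Fiber (d1Sym)
open Summit.QuantumFields.BalabanUV.Beta.GAN24.FibreSymbols (gsum)
open Summit.QuantumFields.BalabanUV.Beta.GAN24.AliasTiling (apt)
open Summit.QuantumFields.BalabanUV.Beta.GAN24.AliasWeightsClosedForm (two_div_pi_mul_le_norm_geomExp)
open Summit.QuantumFields.BalabanUV.Beta.GAN24.PushSumSymbol (cweight)
open Summit.QuantumFields.BalabanUV.Beta.FP.PerfectPropagatorSymbol (quad PinfSym)
open Summit.QuantumFields.BalabanUV.Beta.FP.CoarseCovarianceAlias (covSym covSymMean)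
open Summit.QuantumFields.BalabanUV.Beta.FP.CoarseCovarianceAliasBF (wrapPt wrapPt_mem_BZ wrapPt_mem_Ioc PbfSym covSym_PbfSym_ofRealVec)
open Summit.QuantumFields.BalabanUV.Beta.FP.CoarseCovarianceElliptic (re_quad_PinfSym_nonneg re_quad_PinfSym_ge sum_norm_d1Sym_sq_le sum_sq_le_card_mul_norm_sq)

namespace Summit.QuantumFields.BalabanUV.Beta.FP.CoarseCovarianceEllipticBound

variable {d : ℕ}

/-! ## §1 The wrap on the closed zone; the `l = 0` contour weight -/

/-- [folklore] On the closed zone, wrapping preserves the absolute value of every coordinate (`−π ↦ π`, else identity). -/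
theorem abs_wrapPt_of_mem {s : Fin (d + 1) → ℝ} (hs : s ∈ BZ (d + 1)) (i : Fin (d + 1)) : |wrapPt s i| = |s i| := by
  unfold BZ at hs
  rw [Set.mem_Icc] at hs
  have h1 := hs.1 i
  have h2 := hs.2 i
  by_cases h : s i = -π
  · -- `toIocMod (−π) (−π) = π`
    have : wrapPt s i = π := by
      unfold wrapPt
      rw [h, toIocMod_apply_left]
      ring
    rw [this, h, abs_neg]
  · have hmem : s i ∈ Set.Ioc (-π) (-π + 2 * π) := ⟨lt_of_le_of_ne h1 (Ne.symm h), by linarith⟩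
    have : wrapPt s i = s i := by
      unfold wrapPt
      exact (toIocMod_eq_self _).mpr hmem
    rw [this]

/-- [folklore] `‖wrapPt s‖ = ‖s‖` on the closed zone. -/
theorem norm_wrapPt_of_mem {s : Fin (d + 1) → ℝ} (hs : s ∈ BZ (d + 1)) : ‖wrapPt s‖ = ‖s‖ := by
  simp only [Pi.norm_def]
  congr 1
  refine Finset.sup_congr rfl fun i _ => ?_
  ext
  simp only [coe_nnnorm, Real.norm_eq_abs]
  exact abs_wrapPt_of_mem hs i

/-- [folklore] `wrapPt s ≠ 0` for `s ≠ 0` in the closed zone. -/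
theorem wrapPt_ne_zero_of_mem {s : Fin (d + 1) → ℝ} (hs : s ∈ BZ (d + 1)) (h0 : s ≠ 0) : wrapPt s ≠ 0 := by
  intro h
  have := norm_wrapPt_of_mem hs
  rw [h, norm_zero] at this
  exact h0 (norm_eq_zero.mp this.symm)

/-- [folklore] The `l = 0` alias momentum of a zone momentum lies in the zone: `k∕n ∈ BZ` for `k ∈ BZ`, `n ≥ 1`. -/
theorem apt_zero_mem_BZ (n : ℕ) [NeZero n] {k : Fin (d + 1) → ℝ} (hk : k ∈ BZ (d + 1)) :
    apt n (fun _ => (0 : Fin n)) k ∈ BZ (d + 1) := by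
  have hn : (1 : ℝ) ≤ n := by exact_mod_cast Nat.pos_of_ne_zero (NeZero.ne n)
  have hn0 : (0 : ℝ) < n := by linarith
  unfold BZ at hk ⊢
  rw [Set.mem_Icc] at hk ⊢
  constructor
  · intro i
    have h := hk.1 i
    simp only [apt, Fin.val_zero, Nat.cast_zero, mul_zero, add_zero]
    rw [le_div_iff₀ hn0]; nlinarith [Real.pi_pos]
  · intro i
    have h := hk.2 i
    simp only [apt, Fin.val_zero, Nat.cast_zero, mul_zero, add_zero]
    rw [div_le_iff₀ hn0]; nlinarith [Real.pi_pos]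

/-- [folklore] `apt n 0 k = k∕n` coordinatewise. -/
theorem apt_zero_apply (n : ℕ) [NeZero n] (k : Fin (d + 1) → ℝ) (i : Fin (d + 1)) : apt n (fun _ => (0 : Fin n)) k i = k i / n := by
  simp [apt]

/-- [our object] **THE CONTOUR WEIGHT AT THE `l = 0` ALIAS MOMENTUM IS LARGE**: `(2n∕π)^{d+2} ≤ ‖cweight n κ (ofRealVec (k∕n))‖` for `‖k‖∞ ≤ π`
(road P1 ∕ leaf-17's Jordan bound `two_div_pi_mul_le_norm_geomExp`, `d+2` times). -/
theorem norm_cweight_apt_zero_ge (n : ℕ) [NeZero n] {k : Fin (d + 1) → ℝ} (hk : k ∈ BZ (d + 1)) (κ : Fin (d + 1)) :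
    (2 / Real.pi * n) ^ (d + 2) ≤ ‖cweight n κ (ofRealVec (apt n (fun _ => (0 : Fin n)) k))‖ := by
  have hn1 : 1 ≤ n := Nat.pos_of_ne_zero (NeZero.ne n)
  have hki : ∀ i, |k i| ≤ π := by
    intro i
    unfold BZ at hk; rw [Set.mem_Icc] at hk
    exact abs_le.mpr ⟨hk.1 i, hk.2 i⟩
  have hg : ∀ i, 2 / Real.pi * n ≤ ‖gsum (ofRealVec (apt n (fun _ => (0 : Fin n)) k) i) n‖ := by
    intro i
    have h := two_div_pi_mul_le_norm_geomExp (hki i) hn1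
    have e : ofRealVec (apt n (fun _ => (0 : Fin n)) k) i = ((k i / n : ℝ) : ℂ) := by
      simp only [ofRealVec, apt_zero_apply]
    unfold gsum
    rw [e]
    exact h
  have hpos : 0 ≤ 2 / Real.pi * n := by positivity
  unfold cweight
  rw [norm_mul, norm_prod, pow_succ]
  refine mul_le_mul ?_ (hg κ) hpos (by positivity)
  calc (2 / Real.pi * n) ^ (d + 1) = ∏ _i : Fin (d + 1), (2 / Real.pi * n) := by simp
    _ ≤ ∏ i, ‖gsum (ofRealVec (apt n (fun _ => (0 : Fin n)) k) i) n‖ := Finset.prod_le_prod (fun _ _ => hpos) fun i _ => hg i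

/-! ## §2 The form of `Ĉ_n^{BF}` as an alias average of propagator forms; the named single-term extraction -/

/-- [folklore] The weighted vector `u_λ := conj(q_λ)·v_λ` and the form identity `conj(v κ)·q_κ·P_κλ·conj(q_λ)·v_λ = conj(u_κ)·P_κλ·u_λ`. -/
theorem quad_diag_weight (P : Matrix (Fin (d + 1)) (Fin (d + 1)) ℂ) (q v : Fin (d + 1) → ℂ) :
    ∑ κ, ∑ l, conj (v κ) * (q κ * P κ l * conj (q l)) * v l = quad P (fun l => conj (q l) * v l) := by
  unfold quad
  refine Finset.sum_congr rfl fun κ _ => Finset.sum_congr rfl fun l _ => ?_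
  rw [map_mul, Complex.conj_conj]
  ring

/-- [our object] **THE FORM OF `Ĉ_n^{BF}` IS THE ALIAS AVERAGE OF PROPAGATOR FORMS** at the weighted vectors `u_l := conj(q̂(k,l))·v`:
`Σ_κ Σ_λ conj(v κ)·covSym n κ λ (PbfSym κ λ) (ofRealVec k)·v λ = (n^{d+1})⁻¹ Σ_l quad (P̂(k_l)) u_l`. -/
theorem quad_covSym_PbfSym_eq (n : ℕ) (k : Fin (d + 1) → ℝ) (v : Fin (d + 1) → ℂ) :
    ∑ κ, ∑ l, conj (v κ) * covSym n κ l (PbfSym κ l) (ofRealVec k) * v l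
      = ((n : ℂ) ^ (d + 1))⁻¹ * ∑ a : Fin (d + 1) → Fin n,
          quad (PinfSym (wrapPt (apt n a k)) (d1Sym (wrapPt (apt n a k))))
            (fun l => conj (cweight n l (ofRealVec (apt n a k))) * v l) := by
  have e : ∀ κ l, conj (v κ) * covSym n κ l (PbfSym κ l) (ofRealVec k) * v l
      = ((n : ℂ) ^ (d + 1))⁻¹ * ∑ a : Fin (d + 1) → Fin n, conj (v κ) *
          (cweight n κ (ofRealVec (apt n a k)) * PinfSym (wrapPt (apt n a k)) (d1Sym (wrapPt (apt n a k))) κ l *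
            conj (cweight n l (ofRealVec (apt n a k)))) * v l := by
    intro κ l
    rw [covSym_PbfSym_ofRealVec, Finset.mul_sum, Finset.mul_sum, Finset.sum_mul, Finset.mul_sum]
    refine Finset.sum_congr rfl fun a _ => ?_
    ring
  simp_rw [e, ← Finset.mul_sum]
  congr 1
  rw [Finset.sum_congr rfl fun κ _ => Finset.sum_comm, Finset.sum_comm]
  refine Finset.sum_congr rfl fun a _ => ?_
  exact quad_diag_weight _ _ v

/-- [our object] **THE NAMED SINGLE-ALIAS-TERM EXTRACTION** (owner: «keep the `l = 0` extraction as a NAMED lemma»; IR-3-ELL reuses it): every alias term of `Ĉ_n^{BF}` is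
positive semidefinite, so for ANY alias index `a` and ANY real coarse momentum `k`,
`(n^{d+1})⁻¹ · Re quad (P̂(k_a)) (u_a) ≤ Re Σ_κλ conj(v κ)·covSym n κ λ (PbfSym κ λ) (ofRealVec k)·v λ`, `u_a = conj (cweight n · (k_a))·v`, `k_a = apt n a k`. -/
theorem re_quad_covSym_PbfSym_ge_alias (n : ℕ) [NeZero n] (k : Fin (d + 1) → ℝ) (v : Fin (d + 1) → ℂ) (a : Fin (d + 1) → Fin n) :
    ((n : ℝ) ^ (d + 1))⁻¹ * (quad (PinfSym (wrapPt (apt n a k)) (d1Sym (wrapPt (apt n a k))))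
        (fun l => conj (cweight n l (ofRealVec (apt n a k))) * v l)).re
      ≤ (∑ κ, ∑ l, conj (v κ) * covSym n κ l (PbfSym κ l) (ofRealVec k) * v l).re := by
  rw [quad_covSym_PbfSym_eq]
  have r2 : (((n : ℂ) ^ (d + 1))⁻¹) = ((((n : ℝ) ^ (d + 1))⁻¹ : ℝ) : ℂ) := by push_cast; ring
  rw [r2, Complex.re_ofReal_mul, Complex.re_sum]
  refine mul_le_mul_of_nonneg_left ?_ (by positivity)
  exact Finset.single_le_sum (f := fun a : Fin (d + 1) → Fin n =>
      (quad (PinfSym (wrapPt (apt n a k)) (d1Sym (wrapPt (apt n a k)))) (fun l => conj (cweight n l (ofRealVec (apt n a k))) * v l)).re)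
    (fun a _ => re_quad_PinfSym_nonneg (wrapPt_mem_BZ _) _ _) (Finset.mem_univ a)

/-- [our object] The same extraction for the symbol of record `Ĉ_n^{BF,mean} = (n^{d+2})⁻²·Ĉ_n^{BF}`. -/
theorem re_quad_covSymMean_PbfSym_ge_alias (n : ℕ) [NeZero n] (k : Fin (d + 1) → ℝ) (v : Fin (d + 1) → ℂ) (a : Fin (d + 1) → Fin n) :
    (((n : ℝ) ^ (d + 2))⁻¹) ^ 2 * (((n : ℝ) ^ (d + 1))⁻¹ * (quad (PinfSym (wrapPt (apt n a k)) (d1Sym (wrapPt (apt n a k))))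
        (fun l => conj (cweight n l (ofRealVec (apt n a k))) * v l)).re)
      ≤ (∑ κ, ∑ l, conj (v κ) * covSymMean n κ l (PbfSym κ l) (ofRealVec k) * v l).re := by
  have e : ∀ κ l, conj (v κ) * covSymMean n κ l (PbfSym κ l) (ofRealVec k) * v l
      = (((n : ℂ) ^ (d + 2))⁻¹) ^ 2 * (conj (v κ) * covSym n κ l (PbfSym κ l) (ofRealVec k) * v l) := by
    intro κ l; simp only [covSymMean]; ring
  simp_rw [e, ← Finset.mul_sum]
  have r1 : ((((n : ℂ) ^ (d + 2))⁻¹) ^ 2) = (((((n : ℝ) ^ (d + 2))⁻¹) ^ 2 : ℝ) : ℂ) := by push_cast; ring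
  rw [r1, Complex.re_ofReal_mul]
  exact mul_le_mul_of_nonneg_left (re_quad_covSym_PbfSym_ge_alias n k v a) (by positivity)

/-! ## §3 The ellipticity bound -/

/-- [our object] the explicit ellipticity constant `cEll d := (2∕π)^{2d+4} ∕ ((π²∕4)^{2(d+1)+4}·(d+1))`. -/
theorem cEll_pos (d : ℕ) : 0 < (2 / Real.pi) ^ (2 * d + 4) / ((Real.pi ^ 2 / 4) ^ (2 * (d + 1) + 4) * ((d : ℝ) + 1)) := by positivity

/-- [our object] **n-UNIFORM REAL-ZONE ELLIPTICITY OF THE COARSE COVARIANCE SYMBOL OF RECORD** (IR-2 (iii)): for every `d`, `n ≥ 1`, `k ∈ [−π,π]^{d+1}`, `k ≠ 0`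
and `v : ℂ^{d+1}`,
`(2∕π)^{2d+4}∕((π²∕4)^{2d+6}(d+1)) · n^2 ∕ n^{d+1} · ‖k‖∞⁻² · Σ‖v‖² ≤ Re Σ_κ Σ_λ conj(v κ)·covSymMean n κ λ (PbfSym κ λ) (ofRealVec k)·v λ`
— every alias term is PSD, the `l = 0` term alone gives the bound. -/
theorem re_quad_covSymMean_PbfSym_ge (n : ℕ) [NeZero n] {k : Fin (d + 1) → ℝ} (hk : k ∈ BZ (d + 1)) (hk0 : k ≠ 0) (v : Fin (d + 1) → ℂ) :
    (2 / Real.pi) ^ (2 * d + 4) / ((Real.pi ^ 2 / 4) ^ (2 * (d + 1) + 4) * ((d : ℝ) + 1)) * ((n : ℝ) ^ 2 / (n : ℝ) ^ (d + 1)) / ‖k‖ ^ 2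
        * ∑ α, ‖v α‖ ^ 2
      ≤ (∑ κ, ∑ l, conj (v κ) * covSymMean n κ l (PbfSym κ l) (ofRealVec k) * v l).re := by
  have hn0 : (0 : ℝ) < n := by exact_mod_cast Nat.pos_of_ne_zero (NeZero.ne n)
  have hπ := Real.pi_pos
  set Γ : ℝ := (Real.pi ^ 2 / 4) ^ (2 * (d + 1) + 4) with hΓ
  have hΓpos : 0 < Γ := by positivity
  set s : Fin (d + 1) → ℝ := apt n (fun _ => (0 : Fin n)) k with hsdef
  have hsBZ : s ∈ BZ (d + 1) := apt_zero_mem_BZ n hk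
  have hs0 : s ≠ 0 := by
    intro h
    apply hk0
    funext i
    have := congrFun h i
    rw [hsdef, apt_zero_apply, Pi.zero_apply, div_eq_zero_iff] at this
    rw [Pi.zero_apply]
    rcases this with h1 | h1
    · exact h1
    · exact absurd h1 hn0.ne'
  set s' : Fin (d + 1) → ℝ := wrapPt s with hs'
  have hs'BZ : s' ∈ BZ (d + 1) := wrapPt_mem_BZ s
  have hs'0 : s' ≠ 0 := wrapPt_ne_zero_of_mem hsBZ hs0
  have hph0 : d1Sym s' ≠ 0 := PerfectPropagatorBound.d1Sym_ne_zero hs'BZ hs'0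
  have hnorm_s : ‖s'‖ = ‖k‖ / n := by
    rw [hs', norm_wrapPt_of_mem hsBZ, hsdef]
    have : apt n (fun _ => (0 : Fin n)) k = (n : ℝ)⁻¹ • k := by
      funext i; rw [apt_zero_apply, Pi.smul_apply, smul_eq_mul, div_eq_inv_mul]
    rw [this, norm_smul, Real.norm_eq_abs, abs_of_pos (inv_pos.mpr hn0), div_eq_inv_mul]
  have hk_norm : 0 < ‖k‖ := norm_pos_iff.mpr hk0
  have hph_le : ∑ μ, ‖d1Sym s' μ‖ ^ 2 ≤ ((d : ℝ) + 1) * (‖k‖ / n) ^ 2 := by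
    calc ∑ μ, ‖d1Sym s' μ‖ ^ 2 ≤ ∑ a, s' a ^ 2 := sum_norm_d1Sym_sq_le s'
      _ ≤ ((d : ℝ) + 1) * ‖s'‖ ^ 2 := sum_sq_le_card_mul_norm_sq s'
      _ = ((d : ℝ) + 1) * (‖k‖ / n) ^ 2 := by rw [hnorm_s]
  have hph_pos : 0 < ∑ μ, ‖d1Sym s' μ‖ ^ 2 := PerfectPropagatorBound.sum_norm_sq_pos hph0
  set u : Fin (d + 1) → ℂ := fun l => conj (cweight n l (ofRealVec s)) * v l with hu
  have hu_ge : (2 / Real.pi * n) ^ (2 * (d + 2)) * ∑ α, ‖v α‖ ^ 2 ≤ ∑ α, ‖u α‖ ^ 2 := by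
    rw [Finset.mul_sum]
    refine Finset.sum_le_sum fun α _ => ?_
    have e2 : ‖u α‖ ^ 2 = ‖cweight n α (ofRealVec s)‖ ^ 2 * ‖v α‖ ^ 2 := by
      rw [hu]
      show ‖conj (cweight n α (ofRealVec s)) * v α‖ ^ 2 = _
      rw [norm_mul, Complex.norm_conj, mul_pow]
    rw [e2]
    refine mul_le_mul_of_nonneg_right ?_ (sq_nonneg _)
    calc (2 / Real.pi * n) ^ (2 * (d + 2)) = ((2 / Real.pi * n) ^ (d + 2)) ^ 2 := by ring
      _ ≤ ‖cweight n α (ofRealVec s)‖ ^ 2 := pow_le_pow_left₀ (by positivity) (norm_cweight_apt_zero_ge n hk α) 2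
  have hP : (∑ α, ‖u α‖ ^ 2) / (Γ * ∑ μ, ‖d1Sym s' μ‖ ^ 2) ≤ (quad (PinfSym s' (d1Sym s')) u).re :=
    re_quad_PinfSym_ge hs'BZ hs'0 hph0 u
  -- the extraction at `a = 0`
  have hext := re_quad_covSymMean_PbfSym_ge_alias n k v (fun _ => (0 : Fin n))
  have hden : Γ * ∑ μ, ‖d1Sym s' μ‖ ^ 2 ≤ Γ * (((d : ℝ) + 1) * (‖k‖ / n) ^ 2) := mul_le_mul_of_nonneg_left hph_le hΓpos.le
  have hden_pos : 0 < Γ * ∑ μ, ‖d1Sym s' μ‖ ^ 2 := mul_pos hΓpos hph_pos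
  have step2 : (2 / Real.pi * n) ^ (2 * (d + 2)) * (∑ α, ‖v α‖ ^ 2) / (Γ * (((d : ℝ) + 1) * (‖k‖ / n) ^ 2))
      ≤ (∑ α, ‖u α‖ ^ 2) / (Γ * ∑ μ, ‖d1Sym s' μ‖ ^ 2) := by
    have hnum : 0 ≤ (2 / Real.pi * n) ^ (2 * (d + 2)) * ∑ α, ‖v α‖ ^ 2 := by positivity
    calc (2 / Real.pi * n) ^ (2 * (d + 2)) * (∑ α, ‖v α‖ ^ 2) / (Γ * (((d : ℝ) + 1) * (‖k‖ / n) ^ 2))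
        ≤ (2 / Real.pi * n) ^ (2 * (d + 2)) * (∑ α, ‖v α‖ ^ 2) / (Γ * ∑ μ, ‖d1Sym s' μ‖ ^ 2) :=
          div_le_div_of_nonneg_left hnum hden_pos hden
      _ ≤ (∑ α, ‖u α‖ ^ 2) / (Γ * ∑ μ, ‖d1Sym s' μ‖ ^ 2) := div_le_div_of_nonneg_right hu_ge hden_pos.le
  have key := step2.trans hP
  have hc1 : 0 ≤ (((n : ℝ) ^ (d + 2))⁻¹) ^ 2 := by positivity
  have hc2 : 0 ≤ (((n : ℝ) ^ (d + 1))⁻¹) := by positivity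
  have hgoal : (2 / Real.pi) ^ (2 * d + 4) / ((Real.pi ^ 2 / 4) ^ (2 * (d + 1) + 4) * ((d : ℝ) + 1)) * ((n : ℝ) ^ 2 / (n : ℝ) ^ (d + 1)) / ‖k‖ ^ 2
        * ∑ α, ‖v α‖ ^ 2
      = (((n : ℝ) ^ (d + 2))⁻¹) ^ 2 * ((((n : ℝ) ^ (d + 1))⁻¹) *
          ((2 / Real.pi * n) ^ (2 * (d + 2)) * (∑ α, ‖v α‖ ^ 2) / (Γ * (((d : ℝ) + 1) * (‖k‖ / n) ^ 2)))) := by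
    rw [hΓ]
    field_simp
    ring
  rw [hgoal]
  exact (mul_le_mul_of_nonneg_left (mul_le_mul_of_nonneg_left key hc2) hc1).trans hext

/-- [our object] **THE `d+1 = 4` READING** (road): `cEll 3 · n⁻² · ‖k‖∞⁻² · Σ‖v‖² ≤ Re v†Ĉ_n^{BF,mean}(k)v` — since `‖k‖∞ ≤ π`, `‖k‖∞⁻² ≥ π⁻² ≥ π⁻²·min(1, ‖k‖⁻²)`, this is
H2IR-DESIGN's `c·n⁻²·min(1,|k|⁻²)‖v‖²`. -/
theorem re_quad_covSymMean_PbfSym_ge_four (n : ℕ) [NeZero n] {k : Fin (3 + 1) → ℝ} (hk : k ∈ BZ (3 + 1)) (hk0 : k ≠ 0)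
    (v : Fin (3 + 1) → ℂ) :
    (2 / Real.pi) ^ (2 * 3 + 4) / ((Real.pi ^ 2 / 4) ^ (2 * (3 + 1) + 4) * ((3 : ℝ) + 1)) * ((n : ℝ) ^ 2)⁻¹ / ‖k‖ ^ 2 * ∑ α, ‖v α‖ ^ 2
      ≤ (∑ κ, ∑ l, conj (v κ) * covSymMean n κ l (PbfSym κ l) (ofRealVec k) * v l).re := by
  have h := re_quad_covSymMean_PbfSym_ge n hk hk0 v
  have hn0 : (0 : ℝ) < n := by exact_mod_cast Nat.pos_of_ne_zero (NeZero.ne n)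
  have e : ((n : ℝ) ^ 2 / (n : ℝ) ^ (3 + 1)) = ((n : ℝ) ^ 2)⁻¹ := by
    rw [div_eq_iff (by positivity), show (3 : ℕ) + 1 = 2 + 2 from rfl, pow_add, inv_mul_cancel_left₀ (by positivity)]
  rw [e] at h
  exact h

/-- [our object] **THE DESIGN MEMO's FORM** (`H2IR-DESIGN.md` §IR-2 (iii): `v†Ĉ_n(k)v ≥ c·n⁻²·min(1,|k|⁻²)‖v‖²` at `d+1 = 4`): since `‖k‖⁻² ≥ min(1, ‖k‖⁻²)`,
`cEll · (n²∕n^{d+1}) · min 1 ‖k‖⁻² · Σ‖v‖² ≤ Re v†Ĉ_n^{BF,mean}(k)v` for every `d`. -/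
theorem re_quad_covSymMean_PbfSym_ge_min (n : ℕ) [NeZero n] {k : Fin (d + 1) → ℝ} (hk : k ∈ BZ (d + 1)) (hk0 : k ≠ 0) (v : Fin (d + 1) → ℂ) :
    (2 / Real.pi) ^ (2 * d + 4) / ((Real.pi ^ 2 / 4) ^ (2 * (d + 1) + 4) * ((d : ℝ) + 1)) * ((n : ℝ) ^ 2 / (n : ℝ) ^ (d + 1))
        * min 1 (‖k‖ ^ 2)⁻¹ * ∑ α, ‖v α‖ ^ 2
      ≤ (∑ κ, ∑ l, conj (v κ) * covSymMean n κ l (PbfSym κ l) (ofRealVec k) * v l).re := by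
  refine le_trans ?_ (re_quad_covSymMean_PbfSym_ge n hk hk0 v)
  rw [div_eq_mul_inv _ (‖k‖ ^ 2)]
  refine mul_le_mul_of_nonneg_right (mul_le_mul_of_nonneg_left (min_le_right _ _) (by positivity)) (by positivity)

end Summit.QuantumFields.BalabanUV.Beta.FP.CoarseCovarianceEllipticBound

end
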